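import Literature.NumberTheory.GelbartRogawski1991.LocalSplittingCMBlockRestriction
import Literature.NumberTheory.GelbartRogawski1991.LocalLineModelTransport
import Literature.NumberTheory.GelbartRogawski1991.LocalScaleModelTransport
import HarnessLib

/-!
# The local see-saw for Kudla's CM splitting, read in the LINE MODEL: `restrictLeft` of the line-transported CM section of
# `(U(V₁ ⊥ V₂), U(⟨a⟩))` IS the line-transported CM section of `(U(V₁), U(⟨a⟩))`

Topic `NumberTheory/GelbartRogawski1991`; namespace `Literature.NumberTheory.GelbartRogawski1991.UnitaryDualPair.LocalSplitting.DoubledBlock`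
(sequel of ★ `LocalSplittingCMBlockRestriction`).  THEOREMS ONLY (no definition, no named fact, no `sorry`, no instance, no notation).
Cell `hodgecm-mathlib`, LD2 road R₂ ∕ (P′) (LD2-plan (g2) DEALS #3b plate «(P′)-A13»): `--supports stmt-HodgeConjecture-24832`.

Setting: a CM field `L`, `F = L⁺`, a finite place `v`, Haar data `μ`, a splitting Hecke character `χ`, symmetric Gram matrices `T₁` (DIAGONAL,
`0 < n₁`) and `T₂` with unit determinants, `T_V = T₁ ⊕ᶠ T₂`, a line `⟨a⟩` (`a ∈ F^×`).  The CM pair section of `(U(T_V), U(⟨a⟩))` at `v` is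
`s′ := localSplittingCMWith L (n₁+n₂) ‹gram e T_V (a)› … χ hχ v μ` (`e = Equiv.prodUnique`; ★ `congrW_undoubledSplittings_cmFinLocalFamily_s` reads the
tree's CM θ-package `(𝓢_{λ,a}).s v` as exactly this), and its LINE-MODEL form is `s := lineTransportSection … T_V … a v s′` (★ `LocalLineModelTransport`:
a section of `U(T_V)(F_v)` over `ι^{T_V}_{δ/a}` into `S̃p_ψ(𝕎_v, β_{T_V})` with the SAME operators); likewise `s₁` for `(U(T₁), U(⟨a⟩))`.

* §1 bookkeeping: `gram e (T₁ ⊕ᶠ T₂) (a) = gram e₁ T₁ (a) ⊕ᶠ gram e₂ T₂ (a)` (all three are `a • ·`, ★ `gram_prodUnique_TW`), `gram e (diag t) (a) =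
  diag (a • t)`, and **`(g ⊕ 1) ⊗ 1 = (g ⊗ 1) ⊕ 1`** (`localLineInl_inlLoc`: at `e = Equiv.prodUnique` the Kronecker embedding is the identity on
  matrices, ★ `coe_localLineGL_apply`);
* §2 **THE LINE-MODEL LOCAL SEE-SAW** `restrictLeft (lineTransportSection … (T₁ ⊕ᶠ T₂) … a v s′ …) = lineTransportSection … T₁ … a v s′₁ …`
  (`restrictLeft_lineTransportSection_localSplittingCMWith`): same projections `ι^{T₁}_{δ/a}` (★ `proj_restrictLeft`, ★ `proj_lineTransportSection`),
  same operators by ★ `toRep_inlLoc_boxSB`, ★ `toRep_lineTransportSection`, §1, the ★ local see-saw `toRep_localSplittingCMWith_inlLoc_boxSB_of_eq`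
  (Kudla rigidity) and `⊠`-cancellation (★ `boxSB_left_cancel`, ★ `MpPsi.ext_of_proj_of_toRep`); operator form
  `toRep_lineTransportSection_localSplittingCMWith_inlLoc_boxSB`;
* §3 the same for a VARIABLE `T_V` with `hTV : T_V = T₁ ⊕ᶠ T₂` (`…_of_eq`; the consumer's `T_V` is `realDiagonal L dV hdV`).

So the block-0 sections of the rank-2 CM θ-packages of [Liu2021, Lem. D.1] ARE the rank-one CM sections of the same line, same `λ` — the
«multiplicativity of `ι_μ` over `V₁ ⊕ V₂`» of [Kudla1994, Thm. 3.1] ∕ [HarrisKudlaSweet1996, §1] in the currency of ★ `rankOne_theta_lines_disjoint_of_blockZero_trace_eq_neg`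
(LD2's (P′) socket).  HC_CM is proved only modulo the printed citations (2 remaining named inputs hLiu418 = stmt-HodgeConjecture-24832, h413 = 24833) until rung 0
closes; count-neutral.

## References
* [Kudla1994] S. Kudla, *Splitting metaplectic covers of dual reductive pairs*, Israel J. Math. 87 (1994), §3 Thm. 3.1.
* [Kudla1984] S. Kudla, *Seesaw dual reductive pairs*, Progr. Math. 46 (1984), §1.
* [HarrisKudlaSweet1996] M. Harris, S. Kudla, W. Sweet, J. AMS 9 (1996), §1 (1.9)–(1.16).
* [GelbartRogawski1991] S. Gelbart, J. Rogawski, Invent. Math. 105 (1991), §3.1 Prop. 3.1.1 p. 455, Remark p. 457.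
* [MoeglinVignerasWaldspurger1987] LNM 1291 (1987), Chap. 2 II.1 (A)–(B), Rem. (6).
* [Liu2021] Y. Liu, Camb. J. Math. 9 (2021), App. D §D.1 Steps 1–2 (l. 5217–5219), Lem. D.1 (4).
-/

set_option autoImplicit false

noncomputable section

open NumberField IsDedekindDomain Matrix MeasureTheory
open scoped Kronecker
open Literature.RepresentationTheory.HeisenbergGroup
open Literature.NumberTheory.Automorphic Literature.NumberTheory.Automorphic.UnitaryGroup
open Literature.NumberTheory.Automorphic.Liu2021.Def411WeilCarriers (TW JW JW_eq isSymm_TW isUnit_det_TW)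
open Literature.NumberTheory.GaloisRepresentations
open Literature.RepresentationTheory.HarrisKudlaSweet1996

namespace Literature.NumberTheory.GelbartRogawski1991.UnitaryDualPair.LocalSplitting.DoubledBlock

/-! ## §1 Bookkeeping: the pair Gram of a block sum, and `(g ⊕ 1) ⊗ 1 = (g ⊗ 1) ⊕ 1` -/

section Bookkeeping

variable (F E : Type) [Field F] [NumberField F] [Field E] [NumberField E] [Algebra F E] (c : E ≃ₐ[F] E) (n₁ n₂ : ℕ)

omit [NumberField F] in
/-- `a • (T₁ ⊕ᶠ T₂) = (a • T₁) ⊕ᶠ (a • T₂)`. [cite: Kudla1984, §1] -/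
theorem smul_finSum (t : F) (T₁ : Matrix (Fin n₁) (Fin n₁) F) (T₂ : Matrix (Fin n₂) (Fin n₂) F) :
    t • UnitaryGroup.finSum n₁ n₂ T₁ T₂ = UnitaryGroup.finSum n₁ n₂ (t • T₁) (t • T₂) := by
  rw [UnitaryGroup.finSum, UnitaryGroup.finSum, Matrix.reindex_apply, Matrix.reindex_apply,
    show Matrix.fromBlocks (t • T₁) 0 0 (t • T₂) = t • Matrix.fromBlocks T₁ 0 0 T₂ by simp only [Matrix.fromBlocks_smul, smul_zero]]
  rfl

omit [NumberField F] in
/-- **`gram e (T₁ ⊕ᶠ T₂) (a) = gram e₁ T₁ (a) ⊕ᶠ gram e₂ T₂ (a)`** at the enumerations `Equiv.prodUnique` (all three Gram matrices are `a • ·`).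
[cite: Kudla1984, §1] [cite: GelbartRogawski1991, §3.1 p. 454] -/
theorem gram_prodUnique_finSum_TW (a : Fˣ) (T₁ : Matrix (Fin n₁) (Fin n₁) F) (T₂ : Matrix (Fin n₂) (Fin n₂) F) :
    gram F (Equiv.prodUnique (Fin (n₁ + n₂)) (Fin 1)) (UnitaryGroup.finSum n₁ n₂ T₁ T₂) (TW F a) =
      UnitaryGroup.finSum n₁ n₂ (gram F (Equiv.prodUnique (Fin n₁) (Fin 1)) T₁ (TW F a))
        (gram F (Equiv.prodUnique (Fin n₂) (Fin 1)) T₂ (TW F a)) := by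
  rw [gram_prodUnique_TW, gram_prodUnique_TW, gram_prodUnique_TW, smul_finSum]

omit [NumberField F] in
/-- `gram e (diag t) (a) = diag (a • t)`. [cite: GelbartRogawski1991, §3.1 p. 454] -/
theorem gram_prodUnique_diagonal_TW {n : ℕ} (a : Fˣ) (t : Fin n → F) :
    gram F (Equiv.prodUnique (Fin n) (Fin 1)) (Matrix.diagonal t) (TW F a) = Matrix.diagonal ((a : F) • t) := by
  rw [gram_prodUnique_TW, Matrix.diagonal_smul]

omit [NumberField F] [NumberField E] [Algebra F E] in
/-- at `Equiv.prodUnique`, `M ⊗ 1 = M` (entries `M i j · 1`). [cite: MoeglinVignerasWaldspurger1987, Chap. 1 I.17] -/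
theorem reindex_prodUnique_kronecker_one {R : Type*} [MulZeroOneClass R] {m : Type*} (M : Matrix m m R) :
    Matrix.reindex (Equiv.prodUnique m (Fin 1)) (Equiv.prodUnique m (Fin 1)) (M ⊗ₖ (1 : Matrix (Fin 1) (Fin 1) R)) = M := by
  refine Matrix.ext fun i j => ?_
  rw [Matrix.reindex_apply, Matrix.submatrix_apply, Equiv.prodUnique_symm_apply, Equiv.prodUnique_symm_apply,
    Matrix.kroneckerMap_apply, Matrix.one_apply_eq, mul_one]

variable (v : HeightOneSpectrum (𝓞 F)) {T₁ : Matrix (Fin n₁) (Fin n₁) F} {T₂ : Matrix (Fin n₂) (Fin n₂) F}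
  {J₁ : Matrix (Fin n₁) (Fin n₁) E} (hJ₁ : J₁ = T₁.map (algebraMap F E))
  {J : Matrix (Fin (n₁ + n₂)) (Fin (n₁ + n₂)) E} (hJ : J = (UnitaryGroup.finSum n₁ n₂ T₁ T₂).map (algebraMap F E)) (a : Fˣ)

omit [NumberField F] [NumberField E] in
include hJ₁ in
/-- the pair hermitian matrix of the first block: `reindex e₁ (J₁ ⊗ (a)) = (gram e₁ T₁ (a)) ⊗ 1`. [cite: GelbartRogawski1991, §3.1 p. 454] -/
theorem reindex_kronecker_JW_eq_gram_map :
    Matrix.reindex (Equiv.prodUnique (Fin n₁) (Fin 1)) (Equiv.prodUnique (Fin n₁) (Fin 1)) (J₁ ⊗ₖ JW F E a) =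
      (gram F (Equiv.prodUnique (Fin n₁) (Fin 1)) T₁ (TW F a)).map (algebraMap F E) :=
  reindex_kronecker_eq_gram_map F E (Equiv.prodUnique (Fin n₁) (Fin 1)) hJ₁ (JW_eq F E a)

omit [NumberField F] [NumberField E] in
include hJ in
/-- the pair hermitian matrix of the sum, as a block sum of pair matrices: `reindex e (J ⊗ (a)) = (gram e₁ T₁ (a) ⊕ᶠ gram e₂ T₂ (a)) ⊗ 1`.
[cite: Kudla1984, §1] [cite: GelbartRogawski1991, §3.1 p. 454] -/
theorem reindex_kronecker_JW_eq_finSum_map :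
    Matrix.reindex (Equiv.prodUnique (Fin (n₁ + n₂)) (Fin 1)) (Equiv.prodUnique (Fin (n₁ + n₂)) (Fin 1)) (J ⊗ₖ JW F E a) =
      (UnitaryGroup.finSum n₁ n₂ (gram F (Equiv.prodUnique (Fin n₁) (Fin 1)) T₁ (TW F a))
        (gram F (Equiv.prodUnique (Fin n₂) (Fin 1)) T₂ (TW F a))).map (algebraMap F E) := by
  rw [reindex_kronecker_eq_gram_map F E (Equiv.prodUnique (Fin (n₁ + n₂)) (Fin 1)) hJ (JW_eq F E a), gram_prodUnique_finSum_TW]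

include hJ₁ hJ in
/-- **`(g ⊕ 1) ⊗ 1 = (g ⊗ 1) ⊕ 1`** in `U(J_V ⊗ (a))(F_v)`: the Kronecker embedding `localLineInl` of `U(T₁ ⊕ᶠ T₂)` composed with the block embedding
`inlLoc` of `U(T₁)` is the block embedding of the pair groups composed with the Kronecker embedding of `U(T₁)` (at `e = Equiv.prodUnique` both are
`g_w ↦ g_w ⊕ 1` on matrices). [cite: Kudla1984, §1] [cite: MoeglinVignerasWaldspurger1987, Chap. 1 I.17] -/
theorem localLineInl_inlLoc (g : UnitaryGroup.localPi E c n₁ J₁ v) :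
    localLineInl E c (n₁ + n₂) (Equiv.prodUnique (Fin (n₁ + n₂)) (Fin 1)) J (JW F E a) v (BlockSum.inlLoc F E c v n₁ n₂ hJ₁ hJ g) =
      BlockSum.inlLoc F E c v n₁ n₂ (reindex_kronecker_JW_eq_gram_map F E n₁ hJ₁ a) (reindex_kronecker_JW_eq_finSum_map F E n₁ n₂ hJ a)
        (localLineInl E c n₁ (Equiv.prodUnique (Fin n₁) (Fin 1)) J₁ (JW F E a) v g) := by
  refine Subtype.ext (funext fun w => Units.ext ?_)
  rw [coe_localLineInl, coe_localLineGL_apply, BlockSum.inlLoc_apply, UnitaryGroup.coe_reindexGL, UnitaryGroup.coe_blockDiagGL,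
    Units.val_one, reindex_prodUnique_kronecker_one, BlockSum.inlLoc_apply, UnitaryGroup.coe_reindexGL, UnitaryGroup.coe_blockDiagGL,
    Units.val_one, coe_localLineInl, coe_localLineGL_apply, reindex_prodUnique_kronecker_one]

end Bookkeeping

/-! ## §2 The line-model local see-saw -/

section LineSeeSaw

variable (L : Type) [Field L] [NumberField L] [IsCMField L] (v : HeightOneSpectrum (𝓞 (maximalRealSubfield L)))
  [MeasurableSpace (v.adicCompletion (maximalRealSubfield L))] [BorelSpace (v.adicCompletion (maximalRealSubfield L))]
  (μ : Measure (v.adicCompletion (maximalRealSubfield L))) [μ.IsAddHaarMeasure]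
  (n₁ n₂ : ℕ) {T₁ : Matrix (Fin n₁) (Fin n₁) (maximalRealSubfield L)} {T₂ : Matrix (Fin n₂) (Fin n₂) (maximalRealSubfield L)}
  (hT₁ : T₁.IsSymm) (hT₂ : T₂.IsSymm) (hT₁d : IsUnit T₁.det) (hT₂d : IsUnit T₂.det)
  {J₁ : Matrix (Fin n₁) (Fin n₁) L} (hJ₁ : J₁ = T₁.map (algebraMap (maximalRealSubfield L) L))
  {J : Matrix (Fin (n₁ + n₂)) (Fin (n₁ + n₂)) L} (hJ : J = (UnitaryGroup.finSum n₁ n₂ T₁ T₂).map (algebraMap (maximalRealSubfield L) L))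
  (χ : HeckeCharacter L) (hχ : IsSplittingChar L 1 χ) (a : (maximalRealSubfield L)ˣ)
  (hn₁ : 0 < n₁) (t₁ : Fin n₁ → maximalRealSubfield L) (hT₁t : T₁ = Matrix.diagonal t₁)

/-! The two CM pair sections and their Gram-matrix hypotheses (the `gram`-forms of ★ `localSplittingCMWith`). -/

omit [NumberField L] [IsCMField L] in
include hT₁ in
/-- `gram e₁ T₁ (a)` is symmetric. [cite: GelbartRogawski1991, §3.1 p. 454] -/
theorem isSymm_gramLine₁ : (gram (maximalRealSubfield L) (Equiv.prodUnique (Fin n₁) (Fin 1)) T₁ (TW (maximalRealSubfield L) a)).IsSymm :=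
  isSymm_gram (maximalRealSubfield L) (Equiv.prodUnique (Fin n₁) (Fin 1)) hT₁ (isSymm_TW (maximalRealSubfield L) a)

omit [NumberField L] [IsCMField L] in
include hT₁d in
/-- `gram e₁ T₁ (a)` has unit determinant. [cite: GelbartRogawski1991, §3.1 p. 454] -/
theorem isUnit_det_gramLine₁ :
    IsUnit (gram (maximalRealSubfield L) (Equiv.prodUnique (Fin n₁) (Fin 1)) T₁ (TW (maximalRealSubfield L) a)).det :=
  isUnit_det_gram (maximalRealSubfield L) (Equiv.prodUnique (Fin n₁) (Fin 1)) hT₁d (isUnit_det_TW (maximalRealSubfield L) a)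

set_option maxHeartbeats 1600000 in -- the doubled CM datum's telescope (as in ★ `toRep_localSplittingCMWith_inlLoc_boxSB`)
include hT₂ hT₂d hn₁ hT₁t in
/-- **THE LINE-MODEL LOCAL SEE-SAW, operator form.**  For the CM pair section `s′` of `(U(T₁ ⊕ᶠ T₂), U(⟨a⟩))` and `s′₁` of `(U(T₁), U(⟨a⟩))`
(both ★ `localSplittingCMWith`, same `χ`, `μ`), the line-transported sections satisfy
`ω_{T₁ ⊕ᶠ T₂}(lineTransport s′ (g ⊕ 1))(f₁ ⊠ f₂) = ω_{T₁}(lineTransport s′₁ g) f₁ ⊠ f₂`.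
[cite: Kudla1994, §3 Thm. 3.1] [cite: Kudla1984, §1] [cite: MoeglinVignerasWaldspurger1987, Chap. 2 II.1 Rem. (6)] -/
theorem toRep_lineTransportSection_localSplittingCMWith_inlLoc_boxSB (g : UnitaryGroup.localPi L (IsCMField.complexConj L) n₁ J₁ v)
    (f₁ : SchwartzBruhat (Fin n₁ → v.adicCompletion (maximalRealSubfield L)))
    (f₂ : SchwartzBruhat (Fin n₂ → v.adicCompletion (maximalRealSubfield L))) :
    MpPsi.toRep (localSchrodinger (maximalRealSubfield L) (n₁ + n₂) (UnitaryGroup.finSum n₁ n₂ T₁ T₂) v)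
        (lineTransportSection (maximalRealSubfield L) L (IsCMField.complexConj L) (n₁ + n₂) (complexConj_imagUnit L) (imagUnit_ne_zero L)
          (imagUnit_mul_self L) (UnitaryGroup.finSum n₁ n₂ T₁ T₂) (UnitaryGroup.isSymm_finSum hT₁ hT₂) J hJ a v
          (localSplittingCMWith L (n₁ + n₂)
            (isSymm_gram (maximalRealSubfield L) (Equiv.prodUnique (Fin (n₁ + n₂)) (Fin 1)) (UnitaryGroup.isSymm_finSum hT₁ hT₂)
              (isSymm_TW (maximalRealSubfield L) a))
            (isUnit_det_gram (maximalRealSubfield L) (Equiv.prodUnique (Fin (n₁ + n₂)) (Fin 1)) (isUnit_det_finSum L n₁ n₂ hT₁d hT₂d)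
              (isUnit_det_TW (maximalRealSubfield L) a))
            (reindex_kronecker_eq_gram_map (maximalRealSubfield L) L (Equiv.prodUnique (Fin (n₁ + n₂)) (Fin 1)) hJ (JW_eq (maximalRealSubfield L) L a))
            χ hχ v μ)
          (proj_localSplittingCMWith L (n₁ + n₂) _ _ _ χ hχ v μ)
          (BlockSum.inlLoc (maximalRealSubfield L) L (IsCMField.complexConj L) v n₁ n₂ hJ₁ hJ g))
        (boxSB (v.adicCompletion (maximalRealSubfield L)) (finSumFinEquiv : Fin n₁ ⊕ Fin n₂ ≃ Fin (n₁ + n₂)) f₁ f₂) =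
      boxSB (v.adicCompletion (maximalRealSubfield L)) (finSumFinEquiv : Fin n₁ ⊕ Fin n₂ ≃ Fin (n₁ + n₂))
        (MpPsi.toRep (localSchrodinger (maximalRealSubfield L) n₁ T₁ v)
          (lineTransportSection (maximalRealSubfield L) L (IsCMField.complexConj L) n₁ (complexConj_imagUnit L) (imagUnit_ne_zero L)
            (imagUnit_mul_self L) T₁ hT₁ J₁ hJ₁ a v
            (localSplittingCMWith L n₁ (isSymm_gramLine₁ L n₁ hT₁ a) (isUnit_det_gramLine₁ L n₁ hT₁d a)
              (reindex_kronecker_JW_eq_gram_map (maximalRealSubfield L) L n₁ hJ₁ a) χ hχ v μ)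
            (proj_localSplittingCMWith L n₁ _ _ _ χ hχ v μ) g) f₁) f₂ := by
  rw [toRep_lineTransportSection, toRep_lineTransportSection,
    localLineInl_inlLoc (maximalRealSubfield L) L (IsCMField.complexConj L) n₁ n₂ v hJ₁ hJ a g]
  exact toRep_localSplittingCMWith_inlLoc_boxSB_of_eq L v μ n₁ n₂ (isSymm_gramLine₁ L n₁ hT₁ a)
    (isSymm_gram (maximalRealSubfield L) (Equiv.prodUnique (Fin n₂) (Fin 1)) hT₂ (isSymm_TW (maximalRealSubfield L) a))
    (isUnit_det_gramLine₁ L n₁ hT₁d a)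
    (isUnit_det_gram (maximalRealSubfield L) (Equiv.prodUnique (Fin n₂) (Fin 1)) hT₂d (isUnit_det_TW (maximalRealSubfield L) a))
    (reindex_kronecker_JW_eq_gram_map (maximalRealSubfield L) L n₁ hJ₁ a) χ hχ
    (gram_prodUnique_finSum_TW (maximalRealSubfield L) n₁ n₂ a T₁ T₂) _ _
    (reindex_kronecker_eq_gram_map (maximalRealSubfield L) L (Equiv.prodUnique (Fin (n₁ + n₂)) (Fin 1)) hJ (JW_eq (maximalRealSubfield L) L a))
    hn₁ ((a : maximalRealSubfield L) • t₁) (by rw [hT₁t, gram_prodUnique_diagonal_TW]) _ f₁ f₂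

omit [IsCMField L] [MeasurableSpace (v.adicCompletion (maximalRealSubfield L))] [BorelSpace (v.adicCompletion (maximalRealSubfield L))] in
/-- `1_{𝒪_v^{n₂}} ≠ 0` (its value at `0` is `1`). [folklore] -/
private theorem unitVec_ne_zero' : (unitVec (maximalRealSubfield L) (Fin n₂) v : SchwartzBruhat (Fin n₂ → v.adicCompletion (maximalRealSubfield L))) ≠ 0 :=
  fun h0 => by
    have h1 : ((unitVec (maximalRealSubfield L) (Fin n₂) v : SchwartzBruhat (Fin n₂ → v.adicCompletion (maximalRealSubfield L))) :
        (Fin n₂ → v.adicCompletion (maximalRealSubfield L)) → ℂ) 0 = 1 :=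
      unitVec_apply_of_mem fun i _ => (v.adicCompletionIntegers (maximalRealSubfield L)).zero_mem
    rw [h0, ZeroMemClass.coe_zero, Pi.zero_apply] at h1
    exact zero_ne_one h1

set_option maxHeartbeats 1600000 in -- the doubled CM datum's telescope
include hT₂ hT₂d hn₁ hT₁t in
/-- **THE LINE-MODEL LOCAL SEE-SAW, section form**: `restrictLeft (lineTransport s′) = lineTransport s′₁` in `S̃p_ψ(𝕎_{1,v}, β_{T₁})` —
the block-0 restriction of the line-transported CM pair section of `(U(T₁ ⊕ᶠ T₂), U(⟨a⟩))` IS the line-transported CM pair section of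
`(U(T₁), U(⟨a⟩))` (same projection `ι^{T₁}_{δ/a}`, same operators by `toRep_lineTransportSection_localSplittingCMWith_inlLoc_boxSB` and `⊠`-cancellation).
[cite: Kudla1994, §3 Thm. 3.1] [cite: Kudla1984, §1] [cite: GelbartRogawski1991, §3.1 Prop. 3.1.1 p. 455] -/
theorem restrictLeft_lineTransportSection_localSplittingCMWith :
    BlockSum.restrictLeft (maximalRealSubfield L) L (IsCMField.complexConj L) v n₁ n₂ hJ₁ hJ
        (conj_lineDelta (complexConj_imagUnit L) a) (lineDelta_ne_zero (imagUnit_ne_zero L) a) (lineDelta_mul_self (imagUnit_mul_self L) a)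
        hT₁ hT₂ hT₂d
        (lineTransportSection (maximalRealSubfield L) L (IsCMField.complexConj L) (n₁ + n₂) (complexConj_imagUnit L) (imagUnit_ne_zero L)
          (imagUnit_mul_self L) (UnitaryGroup.finSum n₁ n₂ T₁ T₂) (UnitaryGroup.isSymm_finSum hT₁ hT₂) J hJ a v
          (localSplittingCMWith L (n₁ + n₂)
            (isSymm_gram (maximalRealSubfield L) (Equiv.prodUnique (Fin (n₁ + n₂)) (Fin 1)) (UnitaryGroup.isSymm_finSum hT₁ hT₂)
              (isSymm_TW (maximalRealSubfield L) a))
            (isUnit_det_gram (maximalRealSubfield L) (Equiv.prodUnique (Fin (n₁ + n₂)) (Fin 1)) (isUnit_det_finSum L n₁ n₂ hT₁d hT₂d)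
              (isUnit_det_TW (maximalRealSubfield L) a))
            (reindex_kronecker_eq_gram_map (maximalRealSubfield L) L (Equiv.prodUnique (Fin (n₁ + n₂)) (Fin 1)) hJ (JW_eq (maximalRealSubfield L) L a))
            χ hχ v μ)
          (proj_localSplittingCMWith L (n₁ + n₂) _ _ _ χ hχ v μ))
        (proj_lineTransportSection (maximalRealSubfield L) L (IsCMField.complexConj L) (n₁ + n₂) (complexConj_imagUnit L) (imagUnit_ne_zero L)
          (imagUnit_mul_self L) (UnitaryGroup.finSum n₁ n₂ T₁ T₂) (UnitaryGroup.isSymm_finSum hT₁ hT₂) J hJ a v _ _) =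
      lineTransportSection (maximalRealSubfield L) L (IsCMField.complexConj L) n₁ (complexConj_imagUnit L) (imagUnit_ne_zero L)
        (imagUnit_mul_self L) T₁ hT₁ J₁ hJ₁ a v
        (localSplittingCMWith L n₁ (isSymm_gramLine₁ L n₁ hT₁ a) (isUnit_det_gramLine₁ L n₁ hT₁d a)
          (reindex_kronecker_JW_eq_gram_map (maximalRealSubfield L) L n₁ hJ₁ a) χ hχ v μ)
        (proj_localSplittingCMWith L n₁ _ _ _ χ hχ v μ) := by
  refine MonoidHom.ext fun g => MpPsi.ext_of_proj_of_toRep ?_ fun f₁ => ?_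
  · rw [BlockSum.proj_restrictLeft, proj_lineTransportSection]
  · refine boxSB_left_cancel (v.adicCompletion (maximalRealSubfield L)) (finSumFinEquiv : Fin n₁ ⊕ Fin n₂ ≃ Fin (n₁ + n₂))
      (unitVec_ne_zero' L v n₂) ?_
    rw [← BlockSum.toRep_inlLoc_boxSB,
      toRep_lineTransportSection_localSplittingCMWith_inlLoc_boxSB L v μ n₁ n₂ hT₁ hT₂ hT₁d hT₂d hJ₁ hJ χ hχ a hn₁ t₁ hT₁t]

end LineSeeSaw

/-! ## §3 The same for a VARIABLE pair Gram matrix `T_V = T₁ ⊕ᶠ T₂` (the consumer's `realDiagonal L dV hdV`) -/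

section OfEq

variable (L : Type) [Field L] [NumberField L] [IsCMField L] (v : HeightOneSpectrum (𝓞 (maximalRealSubfield L)))
  [MeasurableSpace (v.adicCompletion (maximalRealSubfield L))] [BorelSpace (v.adicCompletion (maximalRealSubfield L))]
  (μ : Measure (v.adicCompletion (maximalRealSubfield L))) [μ.IsAddHaarMeasure]
  (n₁ n₂ : ℕ) {T₁ : Matrix (Fin n₁) (Fin n₁) (maximalRealSubfield L)} {T₂ : Matrix (Fin n₂) (Fin n₂) (maximalRealSubfield L)}
  (hT₁ : T₁.IsSymm) (hT₂ : T₂.IsSymm) (hT₁d : IsUnit T₁.det) (hT₂d : IsUnit T₂.det)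
  {J₁ : Matrix (Fin n₁) (Fin n₁) L} (hJ₁ : J₁ = T₁.map (algebraMap (maximalRealSubfield L) L))
  {TV : Matrix (Fin (n₁ + n₂)) (Fin (n₁ + n₂)) (maximalRealSubfield L)} (hTV : TV = UnitaryGroup.finSum n₁ n₂ T₁ T₂)
  (hV : TV.IsSymm) (hVd : IsUnit TV.det)
  {JV : Matrix (Fin (n₁ + n₂)) (Fin (n₁ + n₂)) L} (hJV : JV = TV.map (algebraMap (maximalRealSubfield L) L))
  (χ : HeckeCharacter L) (hχ : IsSplittingChar L 1 χ) (a : (maximalRealSubfield L)ˣ)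
  (hn₁ : 0 < n₁) (t₁ : Fin n₁ → maximalRealSubfield L) (hT₁t : T₁ = Matrix.diagonal t₁)

set_option maxHeartbeats 1600000 in -- the doubled CM datum's telescope
include hT₂ hT₂d hTV hn₁ hT₁t in
/-- **THE LINE-MODEL LOCAL SEE-SAW, operator form, for ANY pair Gram matrix EQUAL to a block sum** (`hTV : T_V = T₁ ⊕ᶠ T₂`; here `T_V` is a
variable and the proof is `subst hTV`): `ω_{T_V}(lineTransport s′ (g ⊕ 1))(f₁ ⊠ f₂) = ω_{T₁}(lineTransport s′₁ g) f₁ ⊠ f₂`.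
[cite: Kudla1994, §3 Thm. 3.1] [cite: Kudla1984, §1] [cite: MoeglinVignerasWaldspurger1987, Chap. 2 II.1 Rem. (6)] -/
theorem toRep_lineTransportSection_localSplittingCMWith_inlLoc_boxSB_of_eq (g : UnitaryGroup.localPi L (IsCMField.complexConj L) n₁ J₁ v)
    (f₁ : SchwartzBruhat (Fin n₁ → v.adicCompletion (maximalRealSubfield L)))
    (f₂ : SchwartzBruhat (Fin n₂ → v.adicCompletion (maximalRealSubfield L))) :
    MpPsi.toRep (localSchrodinger (maximalRealSubfield L) (n₁ + n₂) TV v)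
        (lineTransportSection (maximalRealSubfield L) L (IsCMField.complexConj L) (n₁ + n₂) (complexConj_imagUnit L) (imagUnit_ne_zero L)
          (imagUnit_mul_self L) TV hV JV hJV a v
          (localSplittingCMWith L (n₁ + n₂)
            (isSymm_gram (maximalRealSubfield L) (Equiv.prodUnique (Fin (n₁ + n₂)) (Fin 1)) hV (isSymm_TW (maximalRealSubfield L) a))
            (isUnit_det_gram (maximalRealSubfield L) (Equiv.prodUnique (Fin (n₁ + n₂)) (Fin 1)) hVd (isUnit_det_TW (maximalRealSubfield L) a))
            (reindex_kronecker_eq_gram_map (maximalRealSubfield L) L (Equiv.prodUnique (Fin (n₁ + n₂)) (Fin 1)) hJV (JW_eq (maximalRealSubfield L) L a))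
            χ hχ v μ)
          (proj_localSplittingCMWith L (n₁ + n₂) _ _ _ χ hχ v μ)
          (BlockSum.inlLoc (maximalRealSubfield L) L (IsCMField.complexConj L) v n₁ n₂ hJ₁ (hJV.trans (by rw [hTV])) g))
        (boxSB (v.adicCompletion (maximalRealSubfield L)) (finSumFinEquiv : Fin n₁ ⊕ Fin n₂ ≃ Fin (n₁ + n₂)) f₁ f₂) =
      boxSB (v.adicCompletion (maximalRealSubfield L)) (finSumFinEquiv : Fin n₁ ⊕ Fin n₂ ≃ Fin (n₁ + n₂))
        (MpPsi.toRep (localSchrodinger (maximalRealSubfield L) n₁ T₁ v)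
          (lineTransportSection (maximalRealSubfield L) L (IsCMField.complexConj L) n₁ (complexConj_imagUnit L) (imagUnit_ne_zero L)
            (imagUnit_mul_self L) T₁ hT₁ J₁ hJ₁ a v
            (localSplittingCMWith L n₁ (isSymm_gramLine₁ L n₁ hT₁ a) (isUnit_det_gramLine₁ L n₁ hT₁d a)
              (reindex_kronecker_JW_eq_gram_map (maximalRealSubfield L) L n₁ hJ₁ a) χ hχ v μ)
            (proj_localSplittingCMWith L n₁ _ _ _ χ hχ v μ) g) f₁) f₂ := by
  subst hTV
  exact toRep_lineTransportSection_localSplittingCMWith_inlLoc_boxSB L v μ n₁ n₂ hT₁ hT₂ hT₁d hT₂d hJ₁ hJV χ hχ a hn₁ t₁ hT₁t g f₁ f₂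

end OfEq

end Literature.NumberTheory.GelbartRogawski1991.UnitaryDualPair.LocalSplitting.DoubledBlock

end
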